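import Summits.AtomisticToContinuum.Crystallization.Theorems.ThreeConeCertificateSlackRigidityUniqSums

/-!
# Kernel-evaluated plain and weighted hcp floor sums for the unique-maximiser certificate (part G)
(crux `SlackRigidity`, stmt-AtomisticToContinuum-11960, line `ekeland-surgery-parity`, numerics stub
`stub_hcpShapeUniqueMax`)

Exact values of `hcpSumFloorSum p 10000 K e M` (tree) / `hcpSumFloorSumW p 10000 K m e M` (`…UniqSums`)
at the grid points `c = p/10000` of the `F' > 0` certificate on `[7/10, 9/10]`, by `decide +kernel`
(structural recursion, GMP arithmetic; standard axioms).  Values generated and cross-checked by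
`compute/hcpuniq/gen_uniqmax.py` + `floorsum.py` (evidence on the item).
-/

namespace Summit.AtomisticToContinuum.Crystallization.Theorems.EkelandSurgeryParityUniq

open Summit.AtomisticToContinuum.Crystallization.Theorems.ExcessDecayLiouvilleCoarseGrains

/-- `hcpSumFloorSumW 8988 10000 10 2 8 10^110` (`c = 8988/10000`, weight `(k²)^2`, exponent `8`). [folklore] -/
theorem uqFSW_2_8_8988_10 : hcpSumFloorSumW 8988 10000 10 2 8 (10 ^ 110) = 3209462536443831482380298594503656856247934 := by
  decide +kernel

/-- `hcpSumFloorSumW 8991 10000 10 2 8 10^110` (`c = 8991/10000`, weight `(k²)^2`, exponent `8`). [folklore] -/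
theorem uqFSW_2_8_8991_10 : hcpSumFloorSumW 8991 10000 10 2 8 (10 ^ 110) = 3197386899958894502568390335242405732104168 := by
  decide +kernel

/-- `hcpSumFloorSumW 8994 10000 10 2 8 10^110` (`c = 8994/10000`, weight `(k²)^2`, exponent `8`). [folklore] -/
theorem uqFSW_2_8_8994_10 : hcpSumFloorSumW 8994 10000 10 2 8 (10 ^ 110) = 3185358445576943865954427681581302206185634 := by
  decide +kernel

/-- `hcpSumFloorSumW 8996 10000 10 2 8 10^110` (`c = 8996/10000`, weight `(k²)^2`, exponent `8`). [folklore] -/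
theorem uqFSW_2_8_8996_10 : hcpSumFloorSumW 8996 10000 10 2 8 (10 ^ 110) = 3177365594239597665390560237130118111352944 := by
  decide +kernel

/-- `hcpSumFloorSumW 8998 10000 10 2 8 10^110` (`c = 8998/10000`, weight `(k²)^2`, exponent `8`). [folklore] -/
theorem uqFSW_2_8_8998_10 : hcpSumFloorSumW 8998 10000 10 2 8 (10 ^ 110) = 3169393571909893262072622283883451497208558 := by
  decide +kernel

/-- `hcpSumFloorSumW 9000 10000 10 2 8 10^110` (`c = 9000/10000`, weight `(k²)^2`, exponent `8`). [folklore] -/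
theorem uqFSW_2_8_9000_10 : hcpSumFloorSumW 9000 10000 10 2 8 (10 ^ 110) = 3161442322540148170663667551548673496801238 := by
  decide +kernel

/-- Anchor (registered sub-goal `uqKernelWG_anchor` of stmt-AtomisticToContinuum-11960): the first kernel value of this file. [folklore] -/
theorem uqKernelWG_anchor :
    hcpSumFloorSumW 8988 10000 10 2 8 (10 ^ 110) = 3209462536443831482380298594503656856247934 :=
  uqFSW_2_8_8988_10

end Summit.AtomisticToContinuum.Crystallization.Theorems.EkelandSurgeryParityUniq
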